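import Summits.Ventures.PercRepro.C041ZoneSplitDefs
import Summits.Ventures.PercRepro.C041ZoneReductionINV

/-!
# The zone split: the local predicates of a cube state's zone-states, and (H1), (H2) (p6, gen 26; C-041.md §11 (e))

Setting of `C041ZoneSplitDefs`.  For a cube state `S` of a tail-free `O` and an indexed zone `Z`, the zone-state
`restrictZone Z S` extends (`extZone`) to a configuration agreeing with `S` on the edges of `Z`; by the locality lemmas
of `C041ZoneLocal` / `C041ZoneReach` every local predicate of the zone-state is the global predicate of `S` read on `Z`:
`admZone_restrict` (the zone-state is admissible), `kZone_restrict_iff`, `attached_restrict_iff`,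
`reachZone_restrict_iff`, `blueAtK_restrict_iff`, `anchorDeleted_restrict_iff`, `noRedTwoReach_restrict_iff`,
`validZone_restrict_iff`.  From these and the single-state facts (F1)–(F5):

* **(H1)** `restrict_mem_Lset_union_Uset_of_invalid` / `exists_restrict_mem_Lset_of_not_rhoA`: an invalid cube state
  has every zone-state in `𝓛_Z ∪ 𝓤_Z`, and `¬ρ_a(u)` for `u ∈ K₀` puts one of them in `𝓛_Z`;
* **(H2)** `valid_not_goodA_rhoA_of_restrict`: a cube state whose zone-states lie in `𝓡_Z ∪ 𝓤_Z`, one of them in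
  `𝓡_Z`, is valid, not `Good_a`, and has `ρ_a(u)` for every `u ∈ K₀`.
-/

namespace PercRepro

namespace MultiGraph

open Finset

variable {V E : Type*} {G : MultiGraph V E}

section Transfer

variable [Fintype V] (a b c : V) {O : Config E}

omit [Fintype V] in
/-- The extension of a zone-state satisfying the per-edge cube condition is blue-below `O`. -/
theorem blueSub_extZone_of_edge {Z : Finset V} {x : G.ZoneState a b Z}
    (h1 : ∀ e (h : G.ZoneEdge a b Z e), G.Bare a b e → O e = true → x ⟨e, h⟩ = true) :
    G.BlueSub a b O (G.extZone a b O Z x) := by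
  intro e he hSe
  by_cases hZ : G.ZoneEdge a b Z e
  · rw [extZone_of_zoneEdge x hZ] at hSe
    by_contra hO
    have hO' : O e = true := by
      cases h : O e
      · exact absurd h hO
      · rfl
    rw [h1 e hZ he hO'] at hSe
    exact absurd hSe (by decide)
  · rw [extZone_of_bare x hZ he] at hSe
    exact hSe

variable {S : Config E}

omit [Fintype V] in
/-- The per-edge cube condition of the zone-state of a cube state. -/
theorem restrict_edge_cond (hS : ∀ e, G.Bare a b e → O e = true → S e = true) (Z : Finset V) :
    ∀ e (h : G.ZoneEdge a b Z e), G.Bare a b e → O e = true → G.restrictZone a b Z S ⟨e, h⟩ = true :=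
  fun e _ he hO => hS e he hO

/-- **Attachments transfer**: a vertex of the zone `Z = zone z` has the same attachments in `S` and in the extension of
the zone-state of `S`. -/
theorem attached_restrict_iff (hS : ∀ e, G.Bare a b e → O e = true → S e = true) {z v : V}
    (hv : v ∈ G.zone a b O z) {t : V} (ht : t = a ∨ t = b) :
    G.Attached a b (G.extZone a b O (G.zone a b O z) (G.restrictZone a b (G.zone a b O z) S)) v t ↔
      G.Attached a b S v t :=
  (attached_iff_of_agree (blueSub_of_cube hS) (blueSub_extZone_of_edge a b (restrict_edge_cond a b hS _))
    (extZone_restrictZone_agree _ S) hv ht).symm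

omit [Fintype V] in
/-- **`K_Z` transfers**. -/
theorem kZone_restrict_iff (Z : Finset V) (w : V) :
    G.KZone a b c O (G.extZone a b O Z (G.restrictZone a b Z S)) Z w ↔ G.KZone a b c O S Z w := by
  constructor
  · rintro ⟨w₀, hw₀, hK, hwalk⟩
    exact ⟨w₀, hw₀, hK, redIn_walk_of_agree (fun e he => (extZone_restrictZone_agree Z S e he).symm) hwalk⟩
  · rintro ⟨w₀, hw₀, hK, hwalk⟩
    exact ⟨w₀, hw₀, hK, redIn_walk_of_agree (extZone_restrictZone_agree Z S) hwalk⟩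

/-- The zone-state of a cube state is admissible (the per-edge conditions from the cube conditions, the sub-zone
conditions from (F2) through the transfer of attachments). -/
theorem admZone_restrict (hc : c ≠ a ∧ c ≠ b) (hne : a ≠ b) {O S : Config E} (hS : G.IsCubeState a b c O S)
    {Z : Finset V} (hZ : G.IsIdxZone a b c O Z) : G.AdmZone a b c O Z (G.restrictZone a b Z S) := by
  obtain ⟨z, rfl⟩ := hZ.1
  have hadm := (adm_iff a b c hc hne).1 hS.2.2
  refine ⟨restrict_edge_cond a b hS.1 _, fun e _ he hO hx => hS.2.1 e he hO hx, fun v hv hatt => ?_, fun hcz => ?_⟩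
  · rw [attached_restrict_iff a b hS.1 hv (Or.inl rfl), attached_restrict_iff a b hS.1 hv (Or.inr rfl)] at hatt
    have hv' := ne_terminal_of_mem_idxZone hc hZ hv
    exact hadm.2.1 v hv'.1 hv'.2 hatt
  · rw [attached_restrict_iff a b hS.1 hcz (Or.inl rfl), attached_restrict_iff a b hS.1 hcz (Or.inr rfl)]
    exact hadm.2.2

/-- The extension of the zone-state of a cube state is admissible. -/
theorem adm_extZone_restrict (hc : c ≠ a ∧ c ≠ b) (hne : a ≠ b) {O S : Config E} (hS : G.IsCubeState a b c O S)
    {Z : Finset V} (hZ : G.IsIdxZone a b c O Z) :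
    ¬ G.Conn (G.extZone a b O Z (G.restrictZone a b Z S))ᶜ c a ∧
      ¬ G.Conn (G.extZone a b O Z (G.restrictZone a b Z S))ᶜ c b ∧
        ¬ G.Conn (G.extZone a b O Z (G.restrictZone a b Z S))ᶜ a b :=
  adm_extZone hc hne hZ (admZone_restrict a b c hc hne hS hZ)

/-- One direction of the transfer of `REACH_Z` between two admissible configurations blue-below `O` agreeing on the
edges of the indexed zone `Z`. -/
theorem reachZone_of_agree (hc : c ≠ a ∧ c ≠ b) {O S S' : Config E} (hsub : G.BlueSub a b O S)
    (hsub' : G.BlueSub a b O S') (hadm : ¬ G.Conn Sᶜ a b) (hadm' : ¬ G.Conn S'ᶜ a b) {Z : Finset V}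
    (hZ : G.IsIdxZone a b c O Z) (hagree : ∀ e, G.ZoneEdge a b Z e → S' e = S e) {w : V}
    (h : G.ReachZone a b c O S Z w) : G.ReachZone a b c O S' Z w := by
  obtain ⟨z, hZz⟩ := hZ.1
  have hdel : ∀ y ∈ Z, y ∈ G.cluster Sᶜ a ↔ y ∈ G.cluster S'ᶜ a := by
    intro y hy
    have hy' := ne_terminal_of_mem_idxZone hc hZ hy
    rw [mem_cluster_compl_iff_attached a b hadm hy', mem_cluster_compl_iff_attached a b hadm' hy']
    exact attached_iff_of_agree hsub hsub' (hZz ▸ hagree) (hZz ▸ hy) (Or.inl rfl)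
  obtain ⟨w₀, hw₀, hK, hw₀D, hwalk⟩ := h
  refine ⟨w₀, hw₀, hK, fun h' => hw₀D ((hdel w₀ hw₀).2 h'), ?_⟩
  induction hwalk with
  | refl => exact Relation.ReflTransGen.refl
  | @tail x y hwx hxy ih =>
    obtain ⟨⟨e, hZe, he, hSe, hj⟩, hyD⟩ := hxy
    have hy : y ∈ Z := mem_of_redIn_walk hw₀ ((redIn_walk_of_avoiding a b hwx).tail ⟨e, hZe, he, hSe, hj⟩)
    refine ih.tail ⟨⟨e, hZe, he, ?_, hj⟩, fun h' => hyD ((hdel y hy).2 h')⟩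
    rw [hagree e hZe]
    exact hSe

/-- **`REACH_Z` transfers** between a cube state and the extension of its zone-state. -/
theorem reachZone_restrict_iff (hc : c ≠ a ∧ c ≠ b) (hne : a ≠ b) {O S : Config E} (hS : G.IsCubeState a b c O S)
    {Z : Finset V} (hZ : G.IsIdxZone a b c O Z) (w : V) :
    G.ReachZone a b c O (G.extZone a b O Z (G.restrictZone a b Z S)) Z w ↔ G.ReachZone a b c O S Z w := by
  have hsub := blueSub_of_cube hS.1
  have hsub' := blueSub_extZone (admZone_restrict a b c hc hne hS hZ)
  have hadm' := (adm_extZone_restrict a b c hc hne hS hZ).2.2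
  constructor
  · exact reachZone_of_agree a b c hc hsub' hsub hadm' hS.2.2.2.2 hZ
      (fun e he => (extZone_restrictZone_agree Z S e he).symm)
  · exact reachZone_of_agree a b c hc hsub hsub' hS.2.2.2.2 hadm' hZ (extZone_restrictZone_agree Z S)

omit [Fintype V] in
/-- A vertex of `K_Z` lies in `Z`. -/
theorem mem_of_kZone {O S : Config E} {Z : Finset V} {w : V} (h : G.KZone a b c O S Z w) : w ∈ Z := by
  obtain ⟨w₀, hw₀, _, hwalk⟩ := h
  exact mem_of_redIn_walk hw₀ hwalk

omit [Fintype V] in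
/-- A vertex of `REACH_Z` lies in `Z`. -/
theorem mem_of_reachZone {O S : Config E} {Z : Finset V} {w : V} (h : G.ReachZone a b c O S Z w) : w ∈ Z := by
  obtain ⟨w₀, hw₀, _, _, hwalk⟩ := h
  exact mem_of_redIn_walk hw₀ (redIn_walk_of_avoiding a b hwalk)

/-- The zone of a vertex with an attachment is terminal-adjacent: the attachment's vertex lies in the zone and carries
a terminal edge. -/
theorem exists_terminal_of_attached {O S : Config E} (hsub : G.BlueSub a b O S) {v t : V} (ht : t = a ∨ t = b)
    (h : G.Attached a b S v t) : ∃ w ∈ G.zone a b O v, ∃ e, G.Joins e w a ∨ G.Joins e w b := by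
  obtain ⟨w, hvw, e, _, hj⟩ := h
  refine ⟨w, mem_zone_of_blueBareConn hsub (self_mem_zone a b O v) hvw, e, ?_⟩
  rcases ht with rfl | rfl
  · exact Or.inl hj
  · exact Or.inr hj

/-- The zone of a deleted vertex of `K₀` is an indexed zone. -/
theorem isIdxZone_zone_of_deleted (hc : c ≠ a ∧ c ≠ b) {O S : Config E} (hS : G.IsCubeState a b c O S) {w : V}
    (hw : w ∈ G.BareReach a b c O) (hdel : w ∈ G.cluster Sᶜ a) : G.IsIdxZone a b c O (G.zone a b O w) := by
  have hatt := exists_attached_of_mem_bareReach_of_mem_cluster a b c hc hS.2.2.2.2 hw hdel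
  exact ⟨⟨w, rfl⟩, ⟨w, self_mem_zone a b O w, hw⟩,
    exists_terminal_of_attached a b (blueSub_of_cube hS.1) (Or.inl rfl) hatt⟩

/-- **(H1), first half**: every zone-state of an invalid cube state is blue at `K` (by (F3) and the transfer of
`K_Z`). -/
theorem blueAtK_restrict_of_invalid [Fintype E] [DecidableEq E] (hc : c ≠ a ∧ c ≠ b) (hab : ∃ e, G.Joins e a b)
    {O S : Config E}
    (hS : G.IsCubeState a b c O S) (hinv : G.RcInvalid a b c S) (Z : Finset V) :
    G.BlueAtK a b c O Z (G.restrictZone a b Z S) := by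
  intro w hw e hj
  have hwZ : w ∈ Z := mem_of_kZone a b c hw
  rw [kZone_restrict_iff a b c] at hw
  have hwK : w ∈ G.BareReach a b c S := mem_bareReach_of_kZone hS.1 hw
  rw [extZone_restrictZone_agree Z S e (Or.inr ⟨w, hwZ, hj⟩)]
  exact (rcInvalid_iff a b c hc hab hS).1 hinv w hwK e hj

open Classical in
/-- **(H1), first half, as membership**: the zone-states of an invalid cube state lie in `𝓛_Z ∪ 𝓤_Z`. -/
theorem restrict_mem_Lset_union_Uset_of_invalid [Fintype E] [DecidableEq E] (hc : c ≠ a ∧ c ≠ b) (hne : a ≠ b)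
    (hab : ∃ e, G.Joins e a b) {O S : Config E} (hS : G.IsCubeState a b c O S) (hinv : G.RcInvalid a b c S)
    {Z : Finset V} (hZ : G.IsIdxZone a b c O Z) :
    G.restrictZone a b Z S ∈ G.Lset a b c O Z ∪ G.Uset a b c O Z := by
  classical
  rw [Finset.mem_union]
  unfold Lset Uset
  simp only [Finset.mem_filter, Finset.mem_univ, true_and]
  have hadm := admZone_restrict a b c hc hne hS hZ
  have hblue := blueAtK_restrict_of_invalid a b c hc hab hS hinv Z
  by_cases hdel : G.AnchorDeleted a b c O Z (G.restrictZone a b Z S)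
  · exact Or.inl ⟨hadm, hblue, hdel⟩
  · exact Or.inr ⟨hadm, hblue, hdel⟩

open Classical in
/-- **(H1), second half**: `¬ρ_a(u)` for `u ∈ K₀` in an invalid cube state puts the zone-state of a deleted anchor's
zone in `𝓛_Z` (by (F5) and the transfer of attachments). -/
theorem exists_restrict_mem_Lset_of_not_rhoA [Fintype E] [DecidableEq E] (hc : c ≠ a ∧ c ≠ b) (hne : a ≠ b)
    (hab : ∃ e, G.Joins e a b) {O S : Config E} (hS : G.IsCubeState a b c O S) (hinv : G.RcInvalid a b c S)
    {u : V} (hu : u ∈ G.BareReach a b c O) (h : ¬ G.RhoA a c S u) :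
    ∃ Z : G.ZoneIdx a b c O, G.restrictZone a b Z.1 S ∈ G.Lset a b c O Z.1 := by
  classical
  obtain ⟨w, hwK, hdel⟩ := exists_deleted_of_not_rhoA a b c hS.1 hu h
  have hZ := isIdxZone_zone_of_deleted a b c hc hS hwK hdel
  refine ⟨⟨_, hZ⟩, ?_⟩
  unfold Lset
  simp only [Finset.mem_filter, Finset.mem_univ, true_and]
  refine ⟨admZone_restrict a b c hc hne hS hZ, blueAtK_restrict_of_invalid a b c hc hab hS hinv _,
    w, self_mem_zone a b O w, hwK, ?_⟩
  rw [attached_restrict_iff a b hS.1 (self_mem_zone a b O w) (Or.inl rfl)]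
  exact exists_attached_of_mem_bareReach_of_mem_cluster a b c hc hS.2.2.2.2 hwK hdel

open Classical in
/-- **(H2)**: a cube state of a tail-free `O` whose zone-states lie in `𝓡_Z ∪ 𝓤_Z`, one of them in `𝓡_Z`, is valid
(through the `𝓡`-zone, (F3)), not `Good_a` (the first arrival at `b` lands in `REACH_Z` of an indexed zone, (F4), where
`𝓡` forbids a red `b`-edge and `𝓤` forbids a red terminal edge at `K_Z`, (F1)), and has `ρ_a(u)` for every `u ∈ K₀`
(no anchor is deleted, (F5)). -/
theorem valid_not_goodA_rhoA_of_restrict [Fintype E] [DecidableEq E] (hc : c ≠ a ∧ c ≠ b) (hne : a ≠ b)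
    (hab : ∃ e, G.Joins e a b) {O S : Config E} (hO : G.TailFree a b c O) (hS : G.IsCubeState a b c O S)
    (hall : ∀ Z : G.ZoneIdx a b c O, G.restrictZone a b Z.1 S ∈ G.Rset a b c O Z.1 ∪ G.Uset a b c O Z.1)
    (hex : ∃ Z : G.ZoneIdx a b c O, G.restrictZone a b Z.1 S ∈ G.Rset a b c O Z.1) :
    ¬ G.RcInvalid a b c S ∧ ¬ G.WalkAvoiding S (G.cluster Sᶜ a) c b ∧
      ∀ u ∈ G.BareReach a b c O, G.RhoA a c S u := by
  classical
  have hred : ∀ e, G.Joins e a b → S e = true := fun e he => red_of_joins_terminals a b c hS he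
  have hnodel : ∀ w ∈ G.BareReach a b c O, w ∉ G.cluster Sᶜ a := by
    intro w hwK hdel
    have hZ := isIdxZone_zone_of_deleted a b c hc hS hwK hdel
    have hmem := hall ⟨_, hZ⟩
    have hdelZ : G.AnchorDeleted a b c O (G.zone a b O w) (G.restrictZone a b (G.zone a b O w) S) :=
      ⟨w, self_mem_zone a b O w, hwK, (attached_restrict_iff a b hS.1 (self_mem_zone a b O w) (Or.inl rfl)).2
        (exists_attached_of_mem_bareReach_of_mem_cluster a b c hc hS.2.2.2.2 hwK hdel)⟩
    rw [Finset.mem_union] at hmem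
    unfold Rset Uset at hmem
    simp only [Finset.mem_filter, Finset.mem_univ, true_and] at hmem
    rcases hmem with ⟨_, h, _⟩ | ⟨_, _, h⟩ <;> exact h hdelZ
  refine ⟨?_, ?_, fun u hu => rhoA_of_forall_notMem a b c hS.1 hnodel hu⟩
  · obtain ⟨Z, hZmem⟩ := hex
    unfold Rset at hZmem
    simp only [Finset.mem_filter, Finset.mem_univ, true_and] at hZmem
    obtain ⟨w, hw, e, hSe, hj⟩ := hZmem.2.2.2
    have hwZ : w ∈ Z.1 := mem_of_kZone a b c hw
    rw [kZone_restrict_iff a b c] at hw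
    rw [extZone_restrictZone_agree _ S e (Or.inr ⟨w, hwZ, hj⟩)] at hSe
    intro hinv
    exact hinv ((valid_iff a b c hc hab hred).2 ⟨w, mem_bareReach_of_kZone hS.1 hw, e, hSe, hj⟩)
  · intro hgood
    obtain ⟨w, hwalk, _, e, hSe, hj⟩ := exists_bareWalkAvoiding_of_goodA a b c hc hgood
    have hwK : w ∈ G.BareReach a b c S := bareWalk_of_avoiding a b hwalk
    have hZ : G.IsIdxZone a b c O (G.zone a b O w) := by
      refine ⟨⟨w, rfl⟩, ?_, ⟨w, self_mem_zone a b O w, e, Or.inr hj⟩⟩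
      rcases (mem_bareReach_iff_of_tailFree hO hS.1).1 hwK with hK | ⟨w₀, hw₀, hwalk₀⟩
      · exact ⟨w, self_mem_zone a b O w, hK⟩
      · exact ⟨w₀, (mem_zone a b O).2 (blueBareConn_of_openedWalk hwalk₀).symm, hw₀⟩
    have hmem := hall ⟨_, hZ⟩
    have hcD : c ∉ G.cluster Sᶜ a := fun h => hS.2.2.1 ((mem_cluster G).1 h).symm
    have hreach : G.ReachZone a b c O S (G.zone a b O w) w :=
      reachZone_of_bareWalkAvoiding a b c hO hcD (self_mem_zone a b O w) hwalk
    have hZe : G.ZoneEdge a b (G.zone a b O w) e := Or.inr ⟨w, self_mem_zone a b O w, Or.inr hj⟩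
    rw [Finset.mem_union] at hmem
    unfold Rset Uset at hmem
    simp only [Finset.mem_filter, Finset.mem_univ, true_and] at hmem
    rcases hmem with ⟨_, _, hno, _⟩ | ⟨_, hblue, _⟩
    · have := hno w ((reachZone_restrict_iff a b c hc hne hS hZ w).2 hreach) e hj
      rw [extZone_restrictZone_agree _ S e hZe, hSe] at this
      exact absurd this (by decide)
    · have hwKZ : G.KZone a b c O S (G.zone a b O w) w :=
        (mem_bareReach_iff_kZone hO hS.1 (self_mem_zone a b O w)).1 hwK
      have := hblue w ((kZone_restrict_iff a b c _ w).2 hwKZ) e (Or.inr hj)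
      rw [extZone_restrictZone_agree _ S e hZe, hSe] at this
      exact absurd this (by decide)

end Transfer

end MultiGraph

end PercRepro
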